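import Mathlib
import Summits.CriticalPhenomena.SAWScalingLimit.Theorems.NoFoldBound.Negative.BoundaryRayDomain

/-!
# The rigid boundary phases of the witness domain, pair by pair

Crux `NoFoldBound` (stmt-CriticalPhenomena-8296), negative side, third support file of the
BOUNDARY-IDENTITY RAY. For a simply connected domain `Ω` and two boundary mid-edges `b, m` all
self-avoiding walks `b → m` have the same winding (`HexMidEdgeSAW.winding_eq_of_mem_boundary`,
`HexSAWPathRigidity.lean`), hence the same phase `e^{-i(5/8)W}` in the parafermionic observable:
this is `bphase Ω b m` (`BoundaryRayDomain.lean`). For the domain `Ω = rayOmega` of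
`BoundaryRayDomain.lean` we EVALUATE `bphase` on the 21 pairs of boundary mid-edges carrying the
ray (both directions): each value `e^{-i(5/8)(π/3)c}` is certified by an explicit walk
(`exists_walk` of `BoundaryRayMkWalk.lean`, all side conditions by `decide`) whose turning number
`pturn = c` is computed by `decide`. The integers `c` (windings in units of `60°`, from `-600°` to
`+600°`) are those of the certificate `cert_ball_p3_t125.json` attached to the crux item.

Sources: H. Duminil-Copin, S. Smirnov, Ann. of Math. 175 (2012), §2–§3. Sorry-free.
-/

noncomputable section

open Literature.Probability.LatticeModels Literature.Probability.RandomPlanarGeometry.SAW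

namespace Summit.CriticalPhenomena.SAWScalingLimit.Theorems.NoFoldBound.Negative.BoundaryRay

/-- In a simply connected domain, between boundary mid-edges, `bphase` is the phase of EVERY walk
(rigidity of the winding). -/
theorem bphase_eq {Ω : Finset HexVertex} (hΩ : hexDomainSimplyConnected Ω) {b m : Sym2 HexVertex}
    (hb : b ∈ hexDomainBoundary Ω) (hm : m ∈ hexDomainBoundary Ω) (γ : HexMidEdgeSAW Ω b m) :
    bphase Ω b m = Complex.exp (-Complex.I * (5 / 8 : ℝ) * (γ.winding : ℝ)) := by
  have h : Nonempty (HexMidEdgeSAW Ω b m) := ⟨γ⟩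
  rw [bphase, dif_pos h, HexMidEdgeSAW.winding_eq_of_mem_boundary hΩ hb hm (Classical.choice h) γ]

/-- The weight of every walk between boundary mid-edges of a simply connected domain is
`bphase · x^ℓ`. -/
theorem weight_eq_bphase_mul {Ω : Finset HexVertex} (hΩ : hexDomainSimplyConnected Ω)
    {b m : Sym2 HexVertex} (hb : b ∈ hexDomainBoundary Ω) (hm : m ∈ hexDomainBoundary Ω)
    (γ : HexMidEdgeSAW Ω b m) (x : ℝ) :
    γ.weight x (5 / 8) = bphase Ω b m * (x : ℂ) ^ γ.length := by
  rw [HexMidEdgeSAW.weight, bphase_eq hΩ hb hm γ]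

/-- Boundary mid-edges of `Ω` from coordinates: `o ∉ Ω`, `y ∈ Ω`, `o ∼ y`. -/
theorem mem_boundary_rayOmega {o y : HV} (hadj : hvGraph.Adj o y) (ho : o ∉ omegaHV)
    (hy : y ∈ omegaHV) : s(ofHV o, ofHV y) ∈ hexDomainBoundary rayOmega :=
  ⟨(SimpleGraph.mem_edgeSet hexGraph).2 ((hexGraph_adj_ofHV o y).2 hadj), ofHV o, ofHV y, rfl,
    (by rw [mem_rayOmega_iff, toHV_ofHV]; exact hy), (by rw [mem_rayOmega_iff, toHV_ofHV]; exact ho)⟩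

/-- **The phase from explicit walk data**: valid data `(ob, P, om)` with turning number `c` give
`bphase Ω {ob, head P} {last P, om} = e^{-i(5/8)(π/3)c}`. -/
theorem bphase_of_walk {ob om : HV} {P : List HV}
    (h : P ≠ [] ∧ P.Nodup ∧ (ob :: (P ++ [om])).IsChain hvGraph.Adj ∧ (∀ w ∈ P, w ∈ omegaHV) ∧
      ob ∉ omegaHV ∧ om ∉ omegaHV ∧ (P.length = 1 → ob ≠ om))
    (hP : P ≠ []) (hob : hvGraph.Adj ob (P.head hP)) (hom : hvGraph.Adj om (P.getLast hP)) {c : ℤ}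
    (hc : HV.pturn (ob :: (P ++ [om])) = c) :
    bphase rayOmega s(ofHV ob, ofHV (P.head hP)) s(ofHV (P.getLast hP), ofHV om) =
      Complex.exp (-Complex.I * (5 / 8 : ℝ) * ((Real.pi / 3 * c : ℝ))) := by
  obtain ⟨γ, -, hw⟩ := exists_walk mem_rayOmega_iff h hP
  obtain ⟨-, -, -, hsub, hobn, homn, -⟩ := h
  have hb := mem_boundary_rayOmega hob hobn (hsub _ (List.head_mem hP))
  have hm : s(ofHV (P.getLast hP), ofHV om) ∈ hexDomainBoundary rayOmega := by
    rw [Sym2.eq_swap]; exact mem_boundary_rayOmega hom homn (hsub _ (List.getLast_mem hP))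
  rw [bphase_eq rayOmega_simplyConnected hb hm γ, hw, hc]

/-! ### The 21 pairs, both directions (data of `cert_ball_p3_t125.json`) -/

/-- `bphase` #10 → #16 (winding `240°`). -/
theorem bphase_10_16 :
    bphase rayOmega s(ofHV (0, 2, true), ofHV (0, 3, false)) s(ofHV (-2, 2, true), ofHV (-1, 2, false)) =
      Complex.exp (-Complex.I * (5 / 8 : ℝ) * ((Real.pi / 3 * ((4 : ℤ) : ℝ) : ℝ))) :=
  bphase_of_walk (ob := (0, 2, true)) (om := (-1, 2, false))
    (P := [(0, 3, false), (-1, 3, true), (-1, 3, false), (-2, 3, true), (-2, 3, false), (-2, 2, true)])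
    (by decide) (by decide) (by decide) (by decide) (by decide)

/-- `bphase` #16 → #10 (winding `-240°`). -/
theorem bphase_16_10 :
    bphase rayOmega s(ofHV (-1, 2, false), ofHV (-2, 2, true)) s(ofHV (0, 3, false), ofHV (0, 2, true)) =
      Complex.exp (-Complex.I * (5 / 8 : ℝ) * ((Real.pi / 3 * ((-4 : ℤ) : ℝ) : ℝ))) :=
  bphase_of_walk (ob := (-1, 2, false)) (om := (0, 2, true))
    (P := [(-2, 2, true), (-2, 3, false), (-2, 3, true), (-1, 3, false), (-1, 3, true), (0, 3, false)])
    (by decide) (by decide) (by decide) (by decide) (by decide)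

/-- `bphase` #10 → #35 (winding `-240°`). -/
theorem bphase_10_35 :
    bphase rayOmega s(ofHV (0, 2, true), ofHV (0, 3, false)) s(ofHV (3, 0, true), ofHV (3, 0, false)) =
      Complex.exp (-Complex.I * (5 / 8 : ℝ) * ((Real.pi / 3 * ((-4 : ℤ) : ℝ) : ℝ))) :=
  bphase_of_walk (ob := (0, 2, true)) (om := (3, 0, false))
    (P := [(0, 3, false), (0, 3, true), (1, 3, false), (1, 2, true), (2, 2, false), (2, 1, true), (3,
      1, false), (3, 0, true)])
    (by decide) (by decide) (by decide) (by decide) (by decide)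

/-- `bphase` #35 → #10 (winding `240°`). -/
theorem bphase_35_10 :
    bphase rayOmega s(ofHV (3, 0, false), ofHV (3, 0, true)) s(ofHV (0, 3, false), ofHV (0, 2, true)) =
      Complex.exp (-Complex.I * (5 / 8 : ℝ) * ((Real.pi / 3 * ((4 : ℤ) : ℝ) : ℝ))) :=
  bphase_of_walk (ob := (3, 0, false)) (om := (0, 2, true))
    (P := [(3, 0, true), (3, 1, false), (2, 1, true), (2, 2, false), (1, 2, true), (1, 3, false), (0,
      3, true), (0, 3, false)])
    (by decide) (by decide) (by decide) (by decide) (by decide)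

/-- `bphase` #16 → #32 (winding `240°`). -/
theorem bphase_16_32 :
    bphase rayOmega s(ofHV (-1, 2, false), ofHV (-2, 2, true)) s(ofHV (-1, 0, false), ofHV (-1, 0, true)) =
      Complex.exp (-Complex.I * (5 / 8 : ℝ) * ((Real.pi / 3 * ((4 : ℤ) : ℝ) : ℝ))) :=
  bphase_of_walk (ob := (-1, 2, false)) (om := (-1, 0, true))
    (P := [(-2, 2, true), (-2, 2, false), (-2, 1, true), (-2, 1, false), (-2, 0, true), (-1, 0,
      false)])
    (by decide) (by decide) (by decide) (by decide) (by decide)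

/-- `bphase` #32 → #16 (winding `-240°`). -/
theorem bphase_32_16 :
    bphase rayOmega s(ofHV (-1, 0, true), ofHV (-1, 0, false)) s(ofHV (-2, 2, true), ofHV (-1, 2, false)) =
      Complex.exp (-Complex.I * (5 / 8 : ℝ) * ((Real.pi / 3 * ((-4 : ℤ) : ℝ) : ℝ))) :=
  bphase_of_walk (ob := (-1, 0, true)) (om := (-1, 2, false))
    (P := [(-1, 0, false), (-2, 0, true), (-2, 1, false), (-2, 1, true), (-2, 2, false), (-2, 2,
      true)])
    (by decide) (by decide) (by decide) (by decide) (by decide)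

/-- `bphase` #23 → #24 (winding `-60°`). -/
theorem bphase_23_24 :
    bphase rayOmega s(ofHV (-1, 1, true), ofHV (0, 1, false)) s(ofHV (0, 1, false), ofHV (0, 0, true)) =
      Complex.exp (-Complex.I * (5 / 8 : ℝ) * ((Real.pi / 3 * ((-1 : ℤ) : ℝ) : ℝ))) :=
  bphase_of_walk (ob := (-1, 1, true)) (om := (0, 0, true))
    (P := [(0, 1, false)])
    (by decide) (by decide) (by decide) (by decide) (by decide)

/-- `bphase` #24 → #23 (winding `60°`). -/
theorem bphase_24_23 :
    bphase rayOmega s(ofHV (0, 0, true), ofHV (0, 1, false)) s(ofHV (0, 1, false), ofHV (-1, 1, true)) =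
      Complex.exp (-Complex.I * (5 / 8 : ℝ) * ((Real.pi / 3 * ((1 : ℤ) : ℝ) : ℝ))) :=
  bphase_of_walk (ob := (0, 0, true)) (om := (-1, 1, true))
    (P := [(0, 1, false)])
    (by decide) (by decide) (by decide) (by decide) (by decide)

/-- `bphase` #23 → #55 (winding `-540°`). -/
theorem bphase_23_55 :
    bphase rayOmega s(ofHV (-1, 1, true), ofHV (0, 1, false)) s(ofHV (3, -3, false), ofHV (2, -3, true)) =
      Complex.exp (-Complex.I * (5 / 8 : ℝ) * ((Real.pi / 3 * ((-9 : ℤ) : ℝ) : ℝ))) :=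
  bphase_of_walk (ob := (-1, 1, true)) (om := (2, -3, true))
    (P := [(0, 1, false), (0, 1, true), (1, 1, false), (1, 0, true), (1, 0, false), (1, -1, true), (1,
      -1, false), (0, -1, true), (0, -1, false), (-1, -1, true), (-1, 0, false), (-2, 0, true),
      (-2, 1, false), (-2, 1, true), (-2, 2, false), (-2, 2, true), (-2, 3, false), (-2, 3, true),
      (-1, 3, false), (-1, 3, true), (0, 3, false), (0, 3, true), (1, 3, false), (1, 2, true), (2,
      2, false), (2, 1, true), (3, 1, false), (3, 0, true), (4, 0, false), (4, -1, true), (4, -1,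
      false), (4, -2, true), (4, -2, false), (4, -3, true), (4, -3, false), (3, -3, true), (3, -3,
      false)])
    (by decide) (by decide) (by decide) (by decide) (by decide)

/-- `bphase` #55 → #23 (winding `540°`). -/
theorem bphase_55_23 :
    bphase rayOmega s(ofHV (2, -3, true), ofHV (3, -3, false)) s(ofHV (0, 1, false), ofHV (-1, 1, true)) =
      Complex.exp (-Complex.I * (5 / 8 : ℝ) * ((Real.pi / 3 * ((9 : ℤ) : ℝ) : ℝ))) :=
  bphase_of_walk (ob := (2, -3, true)) (om := (-1, 1, true))
    (P := [(3, -3, false), (3, -3, true), (4, -3, false), (4, -3, true), (4, -2, false), (4, -2,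
      true), (4, -1, false), (4, -1, true), (4, 0, false), (3, 0, true), (3, 1, false), (2, 1,
      true), (2, 2, false), (1, 2, true), (1, 3, false), (0, 3, true), (0, 3, false), (-1, 3,
      true), (-1, 3, false), (-2, 3, true), (-2, 3, false), (-2, 2, true), (-2, 2, false), (-2, 1,
      true), (-2, 1, false), (-2, 0, true), (-1, 0, false), (-1, -1, true), (0, -1, false), (0,
      -1, true), (1, -1, false), (1, -1, true), (1, 0, false), (1, 0, true), (1, 1, false), (0, 1,
      true), (0, 1, false)])
    (by decide) (by decide) (by decide) (by decide) (by decide)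

/-- `bphase` #24 → #33 (winding `-300°`). -/
theorem bphase_24_33 :
    bphase rayOmega s(ofHV (0, 0, true), ofHV (0, 1, false)) s(ofHV (1, 0, false), ofHV (0, 0, true)) =
      Complex.exp (-Complex.I * (5 / 8 : ℝ) * ((Real.pi / 3 * ((-5 : ℤ) : ℝ) : ℝ))) :=
  bphase_of_walk (ob := (0, 0, true)) (om := (0, 0, true))
    (P := [(0, 1, false), (0, 1, true), (1, 1, false), (1, 0, true), (1, 0, false)])
    (by decide) (by decide) (by decide) (by decide) (by decide)

/-- `bphase` #33 → #24 (winding `300°`). -/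
theorem bphase_33_24 :
    bphase rayOmega s(ofHV (0, 0, true), ofHV (1, 0, false)) s(ofHV (0, 1, false), ofHV (0, 0, true)) =
      Complex.exp (-Complex.I * (5 / 8 : ℝ) * ((Real.pi / 3 * ((5 : ℤ) : ℝ) : ℝ))) :=
  bphase_of_walk (ob := (0, 0, true)) (om := (0, 0, true))
    (P := [(1, 0, false), (1, 0, true), (1, 1, false), (0, 1, true), (0, 1, false)])
    (by decide) (by decide) (by decide) (by decide) (by decide)

/-- `bphase` #24 → #49 (winding `-120°`). -/
theorem bphase_24_49 :
    bphase rayOmega s(ofHV (0, 0, true), ofHV (0, 1, false)) s(ofHV (1, -2, true), ofHV (2, -2, false)) =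
      Complex.exp (-Complex.I * (5 / 8 : ℝ) * ((Real.pi / 3 * ((-2 : ℤ) : ℝ) : ℝ))) :=
  bphase_of_walk (ob := (0, 0, true)) (om := (2, -2, false))
    (P := [(0, 1, false), (0, 1, true), (1, 1, false), (1, 0, true), (1, 0, false), (1, -1, true), (1,
      -1, false), (1, -2, true)])
    (by decide) (by decide) (by decide) (by decide) (by decide)

/-- `bphase` #49 → #24 (winding `120°`). -/
theorem bphase_49_24 :
    bphase rayOmega s(ofHV (2, -2, false), ofHV (1, -2, true)) s(ofHV (0, 1, false), ofHV (0, 0, true)) =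
      Complex.exp (-Complex.I * (5 / 8 : ℝ) * ((Real.pi / 3 * ((2 : ℤ) : ℝ) : ℝ))) :=
  bphase_of_walk (ob := (2, -2, false)) (om := (0, 0, true))
    (P := [(1, -2, true), (1, -1, false), (1, -1, true), (1, 0, false), (1, 0, true), (1, 1, false),
      (0, 1, true), (0, 1, false)])
    (by decide) (by decide) (by decide) (by decide) (by decide)

/-- `bphase` #24 → #56 (winding `-720°`). -/
theorem bphase_24_56 :
    bphase rayOmega s(ofHV (0, 0, true), ofHV (0, 1, false)) s(ofHV (3, -3, true), ofHV (3, -2, false)) =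
      Complex.exp (-Complex.I * (5 / 8 : ℝ) * ((Real.pi / 3 * ((-12 : ℤ) : ℝ) : ℝ))) :=
  bphase_of_walk (ob := (0, 0, true)) (om := (3, -2, false))
    (P := [(0, 1, false), (0, 1, true), (1, 1, false), (1, 0, true), (1, 0, false), (1, -1, true), (1,
      -1, false), (0, -1, true), (0, -1, false), (-1, -1, true), (-1, 0, false), (-2, 0, true),
      (-2, 1, false), (-2, 1, true), (-2, 2, false), (-2, 2, true), (-2, 3, false), (-2, 3, true),
      (-1, 3, false), (-1, 3, true), (0, 3, false), (0, 3, true), (1, 3, false), (1, 2, true), (2,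
      2, false), (2, 1, true), (3, 1, false), (3, 0, true), (4, 0, false), (4, -1, true), (4, -1,
      false), (4, -2, true), (4, -2, false), (4, -3, true), (4, -3, false), (3, -3, true)])
    (by decide) (by decide) (by decide) (by decide) (by decide)

/-- `bphase` #56 → #24 (winding `720°`). -/
theorem bphase_56_24 :
    bphase rayOmega s(ofHV (3, -2, false), ofHV (3, -3, true)) s(ofHV (0, 1, false), ofHV (0, 0, true)) =
      Complex.exp (-Complex.I * (5 / 8 : ℝ) * ((Real.pi / 3 * ((12 : ℤ) : ℝ) : ℝ))) :=
  bphase_of_walk (ob := (3, -2, false)) (om := (0, 0, true))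
    (P := [(3, -3, true), (4, -3, false), (4, -3, true), (4, -2, false), (4, -2, true), (4, -1,
      false), (4, -1, true), (4, 0, false), (3, 0, true), (3, 1, false), (2, 1, true), (2, 2,
      false), (1, 2, true), (1, 3, false), (0, 3, true), (0, 3, false), (-1, 3, true), (-1, 3,
      false), (-2, 3, true), (-2, 3, false), (-2, 2, true), (-2, 2, false), (-2, 1, true), (-2, 1,
      false), (-2, 0, true), (-1, 0, false), (-1, -1, true), (0, -1, false), (0, -1, true), (1,
      -1, false), (1, -1, true), (1, 0, false), (1, 0, true), (1, 1, false), (0, 1, true), (0, 1,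
      false)])
    (by decide) (by decide) (by decide) (by decide) (by decide)

/-- `bphase` #24 → #60 (winding `-720°`). -/
theorem bphase_24_60 :
    bphase rayOmega s(ofHV (0, 0, true), ofHV (0, 1, false)) s(ofHV (1, -4, true), ofHV (1, -3, false)) =
      Complex.exp (-Complex.I * (5 / 8 : ℝ) * ((Real.pi / 3 * ((-12 : ℤ) : ℝ) : ℝ))) :=
  bphase_of_walk (ob := (0, 0, true)) (om := (1, -3, false))
    (P := [(0, 1, false), (0, 1, true), (1, 1, false), (1, 0, true), (1, 0, false), (1, -1, true), (1,
      -1, false), (0, -1, true), (0, -1, false), (-1, -1, true), (-1, 0, false), (-2, 0, true),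
      (-2, 1, false), (-2, 1, true), (-2, 2, false), (-2, 2, true), (-2, 3, false), (-2, 3, true),
      (-1, 3, false), (-1, 3, true), (0, 3, false), (0, 3, true), (1, 3, false), (1, 2, true), (2,
      2, false), (2, 1, true), (3, 1, false), (3, 0, true), (4, 0, false), (4, -1, true), (4, -1,
      false), (4, -2, true), (4, -2, false), (4, -3, true), (4, -3, false), (3, -3, true), (3, -3,
      false), (3, -4, true), (3, -4, false), (2, -4, true), (2, -4, false), (1, -4, true)])
    (by decide) (by decide) (by decide) (by decide) (by decide)

/-- `bphase` #60 → #24 (winding `720°`). -/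
theorem bphase_60_24 :
    bphase rayOmega s(ofHV (1, -3, false), ofHV (1, -4, true)) s(ofHV (0, 1, false), ofHV (0, 0, true)) =
      Complex.exp (-Complex.I * (5 / 8 : ℝ) * ((Real.pi / 3 * ((12 : ℤ) : ℝ) : ℝ))) :=
  bphase_of_walk (ob := (1, -3, false)) (om := (0, 0, true))
    (P := [(1, -4, true), (2, -4, false), (2, -4, true), (3, -4, false), (3, -4, true), (3, -3,
      false), (3, -3, true), (4, -3, false), (4, -3, true), (4, -2, false), (4, -2, true), (4, -1,
      false), (4, -1, true), (4, 0, false), (3, 0, true), (3, 1, false), (2, 1, true), (2, 2,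
      false), (1, 2, true), (1, 3, false), (0, 3, true), (0, 3, false), (-1, 3, true), (-1, 3,
      false), (-2, 3, true), (-2, 3, false), (-2, 2, true), (-2, 2, false), (-2, 1, true), (-2, 1,
      false), (-2, 0, true), (-1, 0, false), (-1, -1, true), (0, -1, false), (0, -1, true), (1,
      -1, false), (1, -1, true), (1, 0, false), (1, 0, true), (1, 1, false), (0, 1, true), (0, 1,
      false)])
    (by decide) (by decide) (by decide) (by decide) (by decide)


end Summit.CriticalPhenomena.SAWScalingLimit.Theorems.NoFoldBound.Negative.BoundaryRay
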